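import Literature.NumberTheory.QuadraticFields.ThreeTorsionMeanTwoAdic
import Literature.NumberTheory.QuadraticFields.ThreeTorsionMeanProgressionProofs
import Literature.NumberTheory.QuadraticFields.ThreeTorsionMeanProgressionCubicCount
import HarnessLib

/-!
# Taniguchi–Thorne at the prime `2` (`tt_threeTorsion_twoAdic`): the printed reduction to cubic fields, proved

Theorems-only companion (no definition, no named fact; D-0026) of
`ThreeTorsionMeanTwoAdic.lean` — T. Taniguchi, F. Thorne, *Secondary terms in counting functions
for cubic fields*, Duke Math. J. 162 (2013) = arXiv:1102.2914, Thm 4 with §6.3 and Thm 25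
[TaniguchiThorne2013], at the prime `2`.

The printed proofs of Thm 4 and Thm 25 (§6.1: "we use the following classical result of Hasse …
It therefore suffices to count cubic fields which are nowhere totally ramified"; §6.3: "subgroups of
`Cl(D)` of index 3 are in bijection with cubic fields of discriminant `D` … local specifications
for `ℚ(√D)` correspond to local specifications for these cubic fields"; §6.4: "As we are allowing
arbitrary local specifications, it suffices to work with primitive characters … We may handle
imprimitive characters by introducing local specifications"; §6.6: `M₃^±(X, 𝒮; r, χ)`) first
REDUCE both statements to counting theorems for cubic fields with one `2`-adic specification,
twisted by a PRIMITIVE character; the analytic core (Shintani zeta functions / orbital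
`L`-functions with their functional equations and residues, the sieve of §§3–5 with
`Q = X^{5/23} N^{-20/23}`) then proves those. This file PROVES the reduction layer on the tree's
objects, for an abstract count `c : ℤ → ℕ` subject to the dictionary `#Cl₃(D) = 2 c(D) + 1`
(in print `c(D)` = the number of cubic fields of discriminant `D`; the dictionary is Hasse's
theorem, the tree's named fact
`CubicFields.threeTorsion_eq_two_mul_cubicFieldCountOfDisc_add_one`):

* `card_filter_modEq_eq_sum_sixtyFour` — a class modulo `n ∣ 64` inside any finset of integers is
  the disjoint union of the classes modulo `64` above it (bookkeeping for "a specification at `2`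
  is determined by `D (mod 64)`", §6.3);
* `abs_card_negFundDiscrs_twoAdicType_sub_le`, `abs_card_posFundDiscrs_twoAdicType_sub_le` — from
  the tree's PROVED Lemma 21 (`tt_count_quadraticFields_progression_holds`, modulus `64`): the
  quadratic fields of either sign with `|D| < X` and prescribed completion at `2` — type `(r, s)`,
  `D ≡ rs (mod 8r)` — number `X/(r π²) + O(√X)` (the `8/r` admissible classes `mod 64`, each of
  density `1/(8π²)`); this is the trivial-class part of Thm 4 at `2` (footnote to §6.3);
* `tt_twoAdic_sum_neg_iff_cubicCount`, `tt_twoAdic_sum_pos_iff_cubicCount` — under the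
  dictionary, part (i) of the fact at a type is EQUIVALENT to the two-term count of cubic fields
  with that `2`-adic specification: main terms `X/(2 r π²)` (`D < 0`: `C⁻ C'(𝒮)/(2π²)`,
  `C⁻ = 3`, `C'(𝒮) = 1/(3r)`) and `X/(6 r π²)` (`D > 0`, `C⁺ = 1`), error `O_ε(X^{18/23+ε})`;
* `sum_twist_threeTorsion_eq_sum_twist_cubicCount` — under the dictionary the weight
  `χ(D/r) (#Cl₃(D) − 1)/2` of part (ii) is `χ(D/r) c(D)`, i.e. part (ii) is literally the bound
  `M₃^±(X, 𝒮₂; r, χ) = O(X^{18/23+ε})` of Thm 25;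
* `DirichletCharacter.pow_two_eq_one_of_le_three`, `…pow_six_eq_one_of_le_three` — every
  character modulo `2ᵏ`, `k ≤ 3`, satisfies `χ² = 1` (so `χ⁶ = 1`): part (ii) is vacuous below
  `16` (§6.5: "There are no primitive quadratic characters to moduli which are higher powers of
  `2`" is the complementary remark);
* `twist_bound_of_primitive` — the bound of part (ii) for ALL `χ (mod 2ᵏ)` with `χ⁶ ≠ 1` follows
  from the bound for PRIMITIVE `ψ` of conductor `2ʲ`, `j ≥ 4`, `ψ⁶ ≠ 1` (`χ` and its primitive
  character agree on the odd numbers `D/r`; §6.4);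
* `tt_threeTorsion_twoAdic_of_cubicCount` — assembly: the dictionary, the eight-plus-eight cubic
  two-term counts and the primitive twisted bounds imply `tt_threeTorsion_twoAdic`.

What remains for `tt_threeTorsion_twoAdic_holds` is exactly the analytic core of the paper in
`M₃`-form (Thm 4/§6.3: the two-term count of cubic fields with a single `2`-adic specification,
error `X^{18/23+ε}`; Thm 25: `M₃^±(X, 𝒮₂; r, ψ) ≪ X^{18/23+ε}` for primitive `ψ` of conductor
`2ʲ ≥ 16`, `ψ⁶ ≠ 1`) and Hasse's dictionary — none of which is in Mathlib or in this library.

## References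

* T. Taniguchi, F. Thorne, *Secondary terms in counting functions for cubic fields*, Duke Math. J.
  162 (2013) 2451–2508 = arXiv:1102.2914: Thm 4 (p. 3), §6.1 (Hasse, `M₃^±`), §6.2–6.3 (tables,
  "`D (mod 64)`", `C_p = 1 + p⁻¹`, footnote on the trivial class), §6.4 (primitive characters,
  `r`, `N`), Thm 25 (§6.6) [TaniguchiThorne2013].
-/

noncomputable section

open Finset

namespace Literature.NumberTheory.QuadraticFields

/-! ### A class modulo `n ∣ 64` is a disjoint union of classes modulo `64` -/

/-- For `n ∣ 64`, the elements of a finset `S ⊆ ℤ` in the class `c (mod n)` are partitioned by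
their residue modulo `64`, which runs over the residues `b ∈ [0, 64)` with `b ≡ c (mod n)`.
[folklore] -/
theorem card_filter_modEq_eq_sum_sixtyFour (S : Finset ℤ) {n : ℕ} (hn : n ∣ 64) (c : ℤ) :
    (S.filter fun D => D ≡ c [ZMOD n]).card =
      ∑ b ∈ (Finset.range 64).filter (fun b : ℕ => (b : ℤ) ≡ c [ZMOD n]),
        (S.filter fun D => D ≡ b [ZMOD 64]).card := by
  have hn' : (n : ℤ) ∣ 64 := by exact_mod_cast hn
  rw [Finset.card_eq_sum_card_fiberwise (f := fun D : ℤ => (D % 64).toNat)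
      (t := (Finset.range 64).filter (fun b : ℕ => (b : ℤ) ≡ c [ZMOD n])) ?_]
  · refine Finset.sum_congr rfl fun b hb => ?_
    simp only [Finset.mem_filter, Finset.mem_range] at hb
    obtain ⟨hb64, hbc⟩ := hb
    rw [Finset.filter_filter]
    congr 1
    refine Finset.filter_congr fun D _ => ?_
    have h0 : 0 ≤ D % 64 := Int.emod_nonneg D (by norm_num)
    have h1 : D % 64 < 64 := Int.emod_lt_of_pos D (by norm_num)
    constructor
    · rintro ⟨-, hDb⟩
      unfold Int.ModEq
      omega
    · intro hDb
      unfold Int.ModEq at hDb hbc ⊢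
      refine ⟨?_, by omega⟩
      have h64 : D % 64 = b := by omega
      rw [← Int.emod_emod_of_dvd D hn', h64, hbc]
  · intro D hD
    simp only [Finset.coe_filter, Set.mem_setOf_eq] at hD
    simp only [Finset.coe_filter, Finset.mem_range, Set.mem_setOf_eq]
    have h0 : 0 ≤ D % 64 := Int.emod_nonneg D (by norm_num)
    have h1 : D % 64 < 64 := Int.emod_lt_of_pos D (by norm_num)
    refine ⟨by omega, ?_⟩
    have hcast : (((D % 64).toNat : ℕ) : ℤ) = D % 64 := by omega
    unfold Int.ModEq at hD ⊢
    rw [hcast, Int.emod_emod_of_dvd D hn', hD.2]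

/-! ### The number of quadratic fields with prescribed completion at `2` (Lemma 21 at `m = 64`) -/

/-- The density of Lemma 21 at `m = 64`: `c(64, a) = e(a, 2)/(8π²)` (no odd prime divides `64`).
[cite: TaniguchiThorne2013, Lemma 21] -/
theorem ttQuadraticFieldsDensity_sixtyFour (a : ℤ) :
    ttQuadraticFieldsDensity 64 a = ttLocalFactorTwo a / (8 * Real.pi ^ 2) := by
  have h64 : (64 : ℕ).primeFactors = {2} := by
    rw [show (64 : ℕ) = 2 ^ 6 from rfl, Nat.primeFactors_prime_pow (by norm_num) Nat.prime_two]
  have hπ : Real.pi ^ 2 ≠ 0 := by positivity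
  rw [ttQuadraticFieldsDensity, h64, Finset.erase_singleton, Finset.prod_empty]
  field_simp
  ring

/-- On an admissible type `(r, s)` (`e(rs, 2) = 1`) every class `b ≡ rs (mod 8r)` has
`e(b, 2) = 1`: `e(·, 2)` only depends on the residue modulo `16`, and for `r = 1` on the residue
modulo `4`. [cite: TaniguchiThorne2013, Lemma 21] -/
theorem ttLocalFactorTwo_eq_one_of_modEq {r : ℕ} {s : ℤ} (hr : r ∈ ({1, 4, 8} : Finset ℕ))
    (hs : s ∈ ({1, 3, 5, 7} : Finset ℤ)) (he : ttLocalFactorTwo (r * s) = 1) {b : ℤ}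
    (hb : b ≡ r * s [ZMOD ((8 * r : ℕ) : ℤ)]) : ttLocalFactorTwo b = 1 := by
  rw [ttLocalFactorTwo_mul_eq_one_iff hr hs] at he
  simp only [Finset.mem_insert, Finset.mem_singleton] at hs
  unfold Int.ModEq at hb
  unfold ttLocalFactorTwo
  rw [if_pos]
  rcases he with ⟨rfl, rfl | rfl⟩ | ⟨rfl, rfl | rfl⟩ | rfl
  · push_cast at hb; omega
  · push_cast at hb; omega
  · push_cast at hb; omega
  · push_cast at hb; omega
  · push_cast at hb
    rcases hs with rfl | rfl | rfl | rfl <;> omega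

/-- The number of classes modulo `64` above an admissible type `(r, s)` is `8/r`.
[cite: TaniguchiThorne2013, §6.3 ("a specification at 2 is determined by D (mod 64)")] -/
theorem card_range_filter_modEq_type_mul {r : ℕ} {s : ℤ} (hr : r ∈ ({1, 4, 8} : Finset ℕ))
    (hs : s ∈ ({1, 3, 5, 7} : Finset ℤ)) :
    ((Finset.range 64).filter
        (fun b : ℕ => (b : ℤ) ≡ r * s [ZMOD ((8 * r : ℕ) : ℤ)])).card * r = 8 := by
  simp only [Finset.mem_insert, Finset.mem_singleton] at hr hs
  rcases hr with rfl | rfl | rfl <;> rcases hs with rfl | rfl | rfl | rfl <;> decide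

/-- `8r ∣ 64` for `r ∈ {1, 4, 8}`. [folklore] -/
theorem eight_mul_dvd_sixtyFour {r : ℕ} (hr : r ∈ ({1, 4, 8} : Finset ℕ)) : 8 * r ∣ 64 := by
  simp only [Finset.mem_insert, Finset.mem_singleton] at hr
  rcases hr with rfl | rfl | rfl <;> norm_num

/-- `r ≠ 0` (as a real number) for `r ∈ {1, 4, 8}`. [folklore] -/
theorem natCast_ne_zero_of_mem_type {r : ℕ} (hr : r ∈ ({1, 4, 8} : Finset ℕ)) : (r : ℝ) ≠ 0 := by
  simp only [Finset.mem_insert, Finset.mem_singleton] at hr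
  rcases hr with rfl | rfl | rfl <;> norm_num

/-- Summing Lemma 21 over the classes `mod 64` of a type: if every class `b` in a finset `t` of
residues is counted by `|N_b(X) − X/(8π²)| ≤ C_b √X`, then
`|Σ_{b ∈ t} N_b(X) − (#t/(8π²)) X| ≤ (Σ_b C_b) √X`. [folklore] -/
theorem abs_sum_sub_card_mul_le {t : Finset ℕ} {N : ℕ → ℝ} {C : ℕ → ℝ} {X : ℝ}
    (h : ∀ b ∈ t, |N b - 1 / (8 * Real.pi ^ 2) * X| ≤ C b * Real.sqrt X) :
    |(∑ b ∈ t, N b) - (t.card : ℝ) / (8 * Real.pi ^ 2) * X| ≤ (∑ b ∈ t, C b) * Real.sqrt X := by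
  have hrew : (∑ b ∈ t, N b) - (t.card : ℝ) / (8 * Real.pi ^ 2) * X =
      ∑ b ∈ t, (N b - 1 / (8 * Real.pi ^ 2) * X) := by
    rw [Finset.sum_sub_distrib, Finset.sum_const, nsmul_eq_mul]
    ring
  rw [hrew, Finset.sum_mul]
  exact (Finset.abs_sum_le_sum_abs _ _).trans (Finset.sum_le_sum h)

/-- **Quadratic fields with prescribed completion at `2`, imaginary** (Taniguchi–Thorne, Lemma 21
summed over the `8/r` classes `mod 64` of the type; the trivial-class part of Thm 4 at `2`): for an
admissible type `(r, s)`,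
`#{D ∈ negFundDiscrs X : D ≡ rs (mod 8r)} = X/(r π²) + O(√X)`.
[cite: TaniguchiThorne2013, Lemma 21 and §6.3] -/
theorem abs_card_negFundDiscrs_twoAdicType_sub_le {r : ℕ} {s : ℤ}
    (hr : r ∈ ({1, 4, 8} : Finset ℕ)) (hs : s ∈ ({1, 3, 5, 7} : Finset ℤ))
    (he : ttLocalFactorTwo (r * s) = 1) :
    ∃ C : ℝ, ∀ X : ℕ, 1 ≤ X →
      |(((negFundDiscrs X).filter (fun D => D ≡ r * s [ZMOD ((8 * r : ℕ) : ℤ)])).card : ℝ)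
          - 1 / (r * Real.pi ^ 2) * X| ≤ C * Real.sqrt X := by
  choose C hC using fun b : ℕ => tt_count_quadraticFields_progression_holds 64 (b : ℤ) (dvd_refl 64)
  set t := (Finset.range 64).filter (fun b : ℕ => (b : ℤ) ≡ r * s [ZMOD ((8 * r : ℕ) : ℤ)])
    with ht
  have htcard : (t.card : ℝ) / (8 * Real.pi ^ 2) = 1 / (r * Real.pi ^ 2) := by
    have h8 : (t.card : ℝ) * r = 8 := by
      rw [ht]; exact_mod_cast card_range_filter_modEq_type_mul hr hs
    have hr0 := natCast_ne_zero_of_mem_type hr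
    have hπ : Real.pi ^ 2 ≠ 0 := by positivity
    field_simp
    linarith
  refine ⟨∑ b ∈ t, C b, fun X hX => ?_⟩
  have hsplit := card_filter_modEq_eq_sum_sixtyFour (negFundDiscrs X) (eight_mul_dvd_sixtyFour hr)
    ((r : ℤ) * s)
  rw [hsplit, Nat.cast_sum, ← htcard]
  refine abs_sum_sub_card_mul_le fun b hb => ?_
  have hb' : (b : ℤ) ≡ r * s [ZMOD ((8 * r : ℕ) : ℤ)] := (Finset.mem_filter.1 hb).2
  have hdens : ttQuadraticFieldsDensity 64 b = 1 / (8 * Real.pi ^ 2) := by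
    rw [ttQuadraticFieldsDensity_sixtyFour, ttLocalFactorTwo_eq_one_of_modEq hr hs he hb']
  have h := (hC b X hX).1
  rw [hdens] at h
  simpa only [Nat.cast_ofNat] using h

/-- **Quadratic fields with prescribed completion at `2`, real**: for an admissible type `(r, s)`,
`#{D ∈ posFundDiscrs X : D ≡ rs (mod 8r)} = X/(r π²) + O(√X)`.
[cite: TaniguchiThorne2013, Lemma 21 and §6.3] -/
theorem abs_card_posFundDiscrs_twoAdicType_sub_le {r : ℕ} {s : ℤ}
    (hr : r ∈ ({1, 4, 8} : Finset ℕ)) (hs : s ∈ ({1, 3, 5, 7} : Finset ℤ))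
    (he : ttLocalFactorTwo (r * s) = 1) :
    ∃ C : ℝ, ∀ X : ℕ, 1 ≤ X →
      |(((posFundDiscrs X).filter (fun D => D ≡ r * s [ZMOD ((8 * r : ℕ) : ℤ)])).card : ℝ)
          - 1 / (r * Real.pi ^ 2) * X| ≤ C * Real.sqrt X := by
  choose C hC using fun b : ℕ => tt_count_quadraticFields_progression_holds 64 (b : ℤ) (dvd_refl 64)
  set t := (Finset.range 64).filter (fun b : ℕ => (b : ℤ) ≡ r * s [ZMOD ((8 * r : ℕ) : ℤ)])
    with ht
  have htcard : (t.card : ℝ) / (8 * Real.pi ^ 2) = 1 / (r * Real.pi ^ 2) := by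
    have h8 : (t.card : ℝ) * r = 8 := by
      rw [ht]; exact_mod_cast card_range_filter_modEq_type_mul hr hs
    have hr0 := natCast_ne_zero_of_mem_type hr
    have hπ : Real.pi ^ 2 ≠ 0 := by positivity
    field_simp
    linarith
  refine ⟨∑ b ∈ t, C b, fun X hX => ?_⟩
  have hsplit := card_filter_modEq_eq_sum_sixtyFour (posFundDiscrs X) (eight_mul_dvd_sixtyFour hr)
    ((r : ℤ) * s)
  rw [hsplit, Nat.cast_sum, ← htcard]
  refine abs_sum_sub_card_mul_le fun b hb => ?_
  have hb' : (b : ℤ) ≡ r * s [ZMOD ((8 * r : ℕ) : ℤ)] := (Finset.mem_filter.1 hb).2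
  have hdens : ttQuadraticFieldsDensity 64 b = 1 / (8 * Real.pi ^ 2) := by
    rw [ttQuadraticFieldsDensity_sixtyFour, ttLocalFactorTwo_eq_one_of_modEq hr hs he hb']
  have h := (hC b X hX).2
  rw [hdens] at h
  simpa only [Nat.cast_ofNat] using h

/-! ### Part (i) at a type versus the count of cubic fields with that `2`-adic specification -/

/-- **Taniguchi–Thorne §6.1/§6.3, imaginary fields of `2`-adic type `(r, s)`.** Let `c : ℤ → ℕ`
satisfy the dictionary `#Cl₃(D) = 2·c(D) + 1` on negative fundamental discriminants (in print
`c(D)` = the number of cubic fields of discriminant `D`, nowhere totally ramified, with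
`K ⊗ ℚ₂ ≅ (ℚ(√D) ⊗ ℚ₂) × ℚ₂`; Hasse). Then the imaginary half of part (i) of
`tt_threeTorsion_twoAdic` at an admissible type `(r, s)` (main term `2X/(r π²)`) is EQUIVALENT to
the two-term count of cubic fields with that specification at `2`:
`Σ_{-X<D<0, D ≡ rs (8r)} c(D) = X/(2 r π²) + K X^{5/6} + O_ε(X^{18/23+ε})` — the printed
`C⁻ C'(𝒮)/(2π²) X` with `C⁻ = 3`, `C'(𝒮) = 1/(3r)` — by the PROVED count
`Σ_{D ≡ rs (8r)} 1 = X/(r π²) + O(√X)` (`abs_card_negFundDiscrs_twoAdicType_sub_le`).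
[cite: TaniguchiThorne2013, Theorem 4 with §6.1 and §6.3] -/
theorem tt_twoAdic_sum_neg_iff_cubicCount {r : ℕ} {s : ℤ} (hr : r ∈ ({1, 4, 8} : Finset ℕ))
    (hs : s ∈ ({1, 3, 5, 7} : Finset ℤ)) (he : ttLocalFactorTwo (r * s) = 1) {c : ℤ → ℕ}
    (hc : ∀ X : ℕ, ∀ D ∈ negFundDiscrs X, quadFieldThreeTorsion D = 2 * c D + 1) :
    (∃ K : ℝ, ∀ ε : ℝ, 0 < ε → ∃ C : ℝ, ∀ X : ℕ, 1 ≤ X →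
      |(∑ D ∈ (negFundDiscrs X).filter (fun D => D ≡ r * s [ZMOD ((8 * r : ℕ) : ℤ)]),
          (quadFieldThreeTorsion D : ℝ)) - 2 / (r * Real.pi ^ 2) * X
          - K * (X : ℝ) ^ ((5 : ℝ) / 6)| ≤ C * (X : ℝ) ^ ((18 : ℝ) / 23 + ε)) ↔
    (∃ K : ℝ, ∀ ε : ℝ, 0 < ε → ∃ C : ℝ, ∀ X : ℕ, 1 ≤ X →
      |(∑ D ∈ (negFundDiscrs X).filter (fun D => D ≡ r * s [ZMOD ((8 * r : ℕ) : ℤ)]),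
          (c D : ℝ)) - 1 / (2 * r * Real.pi ^ 2) * X
          - K * (X : ℝ) ^ ((5 : ℝ) / 6)| ≤ C * (X : ℝ) ^ ((18 : ℝ) / 23 + ε)) := by
  have hc' : ∀ X : ℕ, ∀ D ∈ (negFundDiscrs X).filter
      (fun D => D ≡ r * s [ZMOD ((8 * r : ℕ) : ℤ)]), quadFieldThreeTorsion D = 2 * c D + 1 :=
    fun X D hD => hc X D (Finset.mem_filter.1 hD).1
  obtain ⟨B, hB⟩ := abs_card_negFundDiscrs_twoAdicType_sub_le hr hs he
  have key := two_term_sum_iff_of_dictionary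
    (S := fun X => (negFundDiscrs X).filter (fun D => D ≡ r * s [ZMOD ((8 * r : ℕ) : ℤ)]))
    (M := 2 / (r * Real.pi ^ 2)) (θ := (18 : ℝ) / 23) (by norm_num) hc' hB
  have hpi : Real.pi ^ 2 ≠ 0 := pow_ne_zero 2 Real.pi_ne_zero
  have hr0 : (r : ℝ) ≠ 0 := natCast_ne_zero_of_mem_type hr
  rwa [show (2 / (r * Real.pi ^ 2) - 1 / (r * Real.pi ^ 2)) / 2 = 1 / (2 * r * Real.pi ^ 2) by
    field_simp; norm_num] at key

/-- **Taniguchi–Thorne §6.1/§6.3, real fields of `2`-adic type `(r, s)`.** With `c` as in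
`tt_twoAdic_sum_neg_iff_cubicCount` on positive fundamental discriminants, the real half of
part (i) at an admissible type `(r, s)` (main term `4X/(3 r π²)`) is EQUIVALENT to
`Σ_{0<D<X, D ≡ rs (8r)} c(D) = X/(6 r π²) + K X^{5/6} + O_ε(X^{18/23+ε})` (`C⁺ C'(𝒮)/(2π²)`,
`C⁺ = 1`). [cite: TaniguchiThorne2013, Theorem 4 with §6.1 and §6.3] -/
theorem tt_twoAdic_sum_pos_iff_cubicCount {r : ℕ} {s : ℤ} (hr : r ∈ ({1, 4, 8} : Finset ℕ))
    (hs : s ∈ ({1, 3, 5, 7} : Finset ℤ)) (he : ttLocalFactorTwo (r * s) = 1) {c : ℤ → ℕ}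
    (hc : ∀ X : ℕ, ∀ D ∈ posFundDiscrs X, quadFieldThreeTorsion D = 2 * c D + 1) :
    (∃ K : ℝ, ∀ ε : ℝ, 0 < ε → ∃ C : ℝ, ∀ X : ℕ, 1 ≤ X →
      |(∑ D ∈ (posFundDiscrs X).filter (fun D => D ≡ r * s [ZMOD ((8 * r : ℕ) : ℤ)]),
          (quadFieldThreeTorsion D : ℝ)) - 4 / (3 * r * Real.pi ^ 2) * X
          - K * (X : ℝ) ^ ((5 : ℝ) / 6)| ≤ C * (X : ℝ) ^ ((18 : ℝ) / 23 + ε)) ↔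
    (∃ K : ℝ, ∀ ε : ℝ, 0 < ε → ∃ C : ℝ, ∀ X : ℕ, 1 ≤ X →
      |(∑ D ∈ (posFundDiscrs X).filter (fun D => D ≡ r * s [ZMOD ((8 * r : ℕ) : ℤ)]),
          (c D : ℝ)) - 1 / (6 * r * Real.pi ^ 2) * X
          - K * (X : ℝ) ^ ((5 : ℝ) / 6)| ≤ C * (X : ℝ) ^ ((18 : ℝ) / 23 + ε)) := by
  have hc' : ∀ X : ℕ, ∀ D ∈ (posFundDiscrs X).filter
      (fun D => D ≡ r * s [ZMOD ((8 * r : ℕ) : ℤ)]), quadFieldThreeTorsion D = 2 * c D + 1 :=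
    fun X D hD => hc X D (Finset.mem_filter.1 hD).1
  obtain ⟨B, hB⟩ := abs_card_posFundDiscrs_twoAdicType_sub_le hr hs he
  have key := two_term_sum_iff_of_dictionary
    (S := fun X => (posFundDiscrs X).filter (fun D => D ≡ r * s [ZMOD ((8 * r : ℕ) : ℤ)]))
    (M := 4 / (3 * r * Real.pi ^ 2)) (θ := (18 : ℝ) / 23) (by norm_num) hc' hB
  have hpi : Real.pi ^ 2 ≠ 0 := pow_ne_zero 2 Real.pi_ne_zero
  have hr0 : (r : ℝ) ≠ 0 := natCast_ne_zero_of_mem_type hr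
  rwa [show (4 / (3 * r * Real.pi ^ 2) - 1 / (r * Real.pi ^ 2)) / 2
      = 1 / (6 * r * Real.pi ^ 2) by field_simp; norm_num] at key

/-! ### Part (ii): the twisted weight, characters below `16`, and primitive characters -/

/-- Under the dictionary `#Cl₃(D) = 2·c(D) + 1` on a finset `S`, the weight of part (ii) is
`χ(D/r) · (#Cl₃(D) − 1)/2 = χ(D/r) · c(D)`: the twisted sum of part (ii) IS the twisted count
`M₃^±(X, 𝒮₂; r, χ) = Σ_K χ(Disc(K)/r)` of cubic fields with the specification (Taniguchi–Thorne
§6.6: "Recall that these are in bijection with pairs of nontrivial 3-torsion elements in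
`Cl(ℚ(√Disc(K)))`"). [cite: TaniguchiThorne2013, §6.6 (definition of M₃) with §6.1] -/
theorem sum_twist_threeTorsion_eq_sum_twist_cubicCount (S : Finset ℤ) {c : ℤ → ℕ}
    (hc : ∀ D ∈ S, quadFieldThreeTorsion D = 2 * c D + 1) (v : ℤ → ℂ) :
    ∑ D ∈ S, v D * (((quadFieldThreeTorsion D : ℂ) - 1) / 2) = ∑ D ∈ S, v D * (c D : ℂ) := by
  refine Finset.sum_congr rfl fun D hD => ?_
  rw [hc D hD]
  push_cast
  ring

/-- Below `16` every unit squares to `1`: `u² = 1` for `u ∈ (ℤ/2ᵏ)ˣ`, `k ≤ 3`. [folklore] -/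
theorem units_zmod_two_pow_sq_eq_one {k : ℕ} (hk : k ≤ 3) (u : (ZMod (2 ^ k))ˣ) : u ^ 2 = 1 := by
  interval_cases k <;> revert u <;> decide

/-- **No character of order `> 2` below `16`**: every Dirichlet character modulo `2ᵏ` with
`k ≤ 3` satisfies `χ² = 1` (the group `(ℤ/8)ˣ` has exponent `2`). Hence part (ii) of
`tt_threeTorsion_twoAdic` (characters with `χ⁶ ≠ 1`) only speaks about moduli `2ᵏ ≥ 16`
(Taniguchi–Thorne §6.5: the quadratic characters of conductor `4` and `8` are constant on each
`2`-adic type, and "there are no primitive quadratic characters to moduli which are higher powers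
of 2"). [cite: TaniguchiThorne2013, §6.5 (p = 2)] -/
theorem dirichletCharacter_pow_two_eq_one_of_le_three {k : ℕ} (hk : k ≤ 3)
    (χ : DirichletCharacter ℂ (2 ^ k)) : χ ^ 2 = 1 := by
  refine MulChar.ext fun u => ?_
  rw [MulChar.pow_apply_coe, ← map_pow, ← Units.val_pow_eq_pow_val,
    units_zmod_two_pow_sq_eq_one hk u, Units.val_one, map_one, MulChar.one_apply_coe]

/-- In particular `χ⁶ = 1` for every `χ (mod 2ᵏ)`, `k ≤ 3`. [folklore] -/
theorem dirichletCharacter_pow_six_eq_one_of_le_three {k : ℕ} (hk : k ≤ 3)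
    (χ : DirichletCharacter ℂ (2 ^ k)) : χ ^ 6 = 1 := by
  rw [show (6 : ℕ) = 2 * 3 from rfl, pow_mul, dirichletCharacter_pow_two_eq_one_of_le_three hk χ,
    one_pow]

/-- So part (ii) is vacuously true for `k ≤ 3`: the hypothesis `χ⁶ ≠ 1` is never met.
[folklore] -/
theorem four_le_of_pow_six_ne_one {k : ℕ} {χ : DirichletCharacter ℂ (2 ^ k)} (hχ : χ ^ 6 ≠ 1) :
    4 ≤ k := by
  by_contra h
  exact hχ (dirichletCharacter_pow_six_eq_one_of_le_three (by omega) χ)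

/-- An odd integer is coprime to `2`. [folklore] -/
theorem isCoprime_two_of_emod_two_eq_one {a : ℤ} (ha : a % 2 = 1) : IsCoprime a 2 :=
  ⟨1, -(a / 2), by omega⟩

/-- On a `2`-adic type `(r, s)` the quotient `D/r` is odd (`D = r(s + 8t)`, `s` odd) — so that
`χ(Disc(K)/r) ≠ 0`, Taniguchi–Thorne §6.4: "our local specifications `𝒮` include a restriction to
those fields `K` whose discriminants satisfy `r ∣ Disc(K)` and `(m, Disc(K)/r) = 1`".
[cite: TaniguchiThorne2013, §6.4] -/
theorem ediv_emod_two_eq_one_of_modEq_type {r : ℕ} {s : ℤ} (hr : r ∈ ({1, 4, 8} : Finset ℕ))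
    (hs : s ∈ ({1, 3, 5, 7} : Finset ℤ)) {D : ℤ} (hD : D ≡ r * s [ZMOD ((8 * r : ℕ) : ℤ)]) :
    D / (r : ℤ) % 2 = 1 := by
  simp only [Finset.mem_insert, Finset.mem_singleton] at hr hs
  have hs2 : s % 2 = 1 := by rcases hs with rfl | rfl | rfl | rfl <;> norm_num
  unfold Int.ModEq at hD
  rcases hr with rfl | rfl | rfl
  · push_cast at hD ⊢; omega
  · push_cast at hD ⊢; omega
  · push_cast at hD ⊢; omega

/-- **Reduction of part (ii) to primitive characters** (Taniguchi–Thorne §6.4: "As we are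
allowing arbitrary local specifications, it suffices to work with primitive characters … We may
handle imprimitive characters by introducing local specifications corresponding to the condition
`χ(n) = 0`"). Let `S X` be finsets of integers on which `D/r` is odd and `w` any weight. If for
every `j ≥ 4` and every PRIMITIVE `ψ (mod 2ʲ)` with `ψ⁶ ≠ 1` the twisted sums
`Σ_{D ∈ S X} ψ(D/r) w(D)` are `O_ε(X^{θ+ε})`, then the same holds for every `χ (mod 2ᵏ)` with
`χ⁶ ≠ 1`, any `k`: `χ` is induced from its primitive character `ψ`, of conductor `2ʲ ∣ 2ᵏ`, the
two agree on odd arguments, `ψ⁶ ≠ 1`, and `j ≥ 4` by `dirichletCharacter_pow_six_eq_one_of_le_three`.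
[cite: TaniguchiThorne2013, §6.4 (Notation and conventions)] -/
theorem twist_bound_of_primitive {r : ℕ} {S : ℕ → Finset ℤ} {w : ℤ → ℂ} {θ : ℝ}
    (hodd : ∀ X : ℕ, ∀ D ∈ S X, D / (r : ℤ) % 2 = 1)
    (H : ∀ j : ℕ, 4 ≤ j → ∀ ψ : DirichletCharacter ℂ (2 ^ j), ψ.IsPrimitive → ψ ^ 6 ≠ 1 →
      ∀ ε : ℝ, 0 < ε → ∃ C : ℝ, ∀ X : ℕ, 1 ≤ X →
        ‖∑ D ∈ S X, ψ (((D / (r : ℤ) : ℤ)) : ZMod (2 ^ j)) * w D‖ ≤ C * (X : ℝ) ^ (θ + ε))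
    {k : ℕ} (χ : DirichletCharacter ℂ (2 ^ k)) (hχ : χ ^ 6 ≠ 1) :
    ∀ ε : ℝ, 0 < ε → ∃ C : ℝ, ∀ X : ℕ, 1 ≤ X →
      ‖∑ D ∈ S X, χ (((D / (r : ℤ) : ℤ)) : ZMod (2 ^ k)) * w D‖ ≤ C * (X : ℝ) ^ (θ + ε) := by
  -- the conductor of `χ` is a power of `2`
  obtain ⟨j, -, hj⟩ := (Nat.dvd_prime_pow Nat.prime_two).1 χ.conductor_dvd_level
  -- transport the primitive character of `χ` to the level `2 ^ j`
  set ψ : DirichletCharacter ℂ (2 ^ j) :=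
    DirichletCharacter.changeLevel (dvd_of_eq hj) χ.primitiveCharacter with hψ
  have hψprim : ψ.IsPrimitive := by
    rw [DirichletCharacter.isPrimitive_def, hψ, DirichletCharacter.conductor_changeLevel, ← hj]
    exact χ.primitiveCharacter_isPrimitive
  have hψ6 : ψ ^ 6 ≠ 1 := by
    intro h6
    apply hχ
    have h0 : χ.primitiveCharacter ^ 6 = 1 := by
      rw [hψ, ← map_pow, DirichletCharacter.changeLevel_eq_one_iff] at h6
      exact h6
    rw [← DirichletCharacter.changeLevel_primitiveCharacter χ, ← map_pow, h0, map_one]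
  have hj4 : 4 ≤ j := four_le_of_pow_six_ne_one hψ6
  -- `χ` and `ψ` agree on odd arguments
  have hval : ∀ a : ℤ, a % 2 = 1 →
      χ ((a : ZMod (2 ^ k))) = ψ ((a : ZMod (2 ^ j))) := by
    intro a ha
    have h2 : IsCoprime a 2 := isCoprime_two_of_emod_two_eq_one ha
    have hk' : IsCoprime a ((2 ^ k : ℕ) : ℤ) := by push_cast; exact h2.pow_right
    have hj' : IsCoprime a ((2 ^ j : ℕ) : ℤ) := by push_cast; exact h2.pow_right
    rw [← DirichletCharacter.primitiveCharacter_apply_of_isCoprime χ hk', hψ,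
      DirichletCharacter.changeLevel_eq_cast_of_dvd' _ _ hj']
  intro ε hε
  obtain ⟨C, hC⟩ := H j hj4 ψ hψprim hψ6 ε hε
  refine ⟨C, fun X hX => ?_⟩
  have hsum : ∑ D ∈ S X, χ (((D / (r : ℤ) : ℤ)) : ZMod (2 ^ k)) * w D
      = ∑ D ∈ S X, ψ (((D / (r : ℤ) : ℤ)) : ZMod (2 ^ j)) * w D :=
    Finset.sum_congr rfl fun D hD => by rw [hval _ (hodd X D hD)]
  rw [hsum]
  exact hC X hX

/-! ### Assembly: the fact from the cubic-field statements -/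

/-- **`tt_threeTorsion_twoAdic` from the paper's statements about cubic fields** (the reduction
of Taniguchi–Thorne §6.1/§6.3/§6.4/§6.6, proved). Let `c : ℤ → ℕ` satisfy Hasse's dictionary
`#Cl₃(D) = 2·c(D) + 1` on fundamental discriminants (`c(D)` = the number of cubic fields of
discriminant `D`). Assume, for every admissible `2`-adic type `(r, s)`:
(1) [Thm 4 with §6.3, in `M₃`-form] the two-term counts
`Σ_{-X<D<0, D ≡ rs (8r)} c(D) = X/(2rπ²) + K⁻ X^{5/6} + O_ε(X^{18/23+ε})` and
`Σ_{0<D<X, D ≡ rs (8r)} c(D) = X/(6rπ²) + K⁺ X^{5/6} + O_ε(X^{18/23+ε})`;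
(2) [Thm 25, `χ⁶ ≠ 1`, primitive] for every `j ≥ 4` and every primitive `ψ (mod 2ʲ)` with
`ψ⁶ ≠ 1`, `Σ_{0<∓D<X, D ≡ rs (8r)} ψ(D/r) c(D) = O_ε(X^{18/23+ε})`.
Then `tt_threeTorsion_twoAdic` holds. What is assumed is exactly the analytic content of the two
theorems at the prime `2` (Shintani zeta functions and orbital `L`-functions with one `2`-adic
specification); everything else in their printed deduction is proved above.
[cite: TaniguchiThorne2013, Theorem 4 (§6.3) and Theorem 25 (§6.4, §6.6)] -/
theorem tt_threeTorsion_twoAdic_of_cubicCount {c : ℤ → ℕ}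
    (hdict : ∀ D : ℤ, ((D % 4 = 1 ∧ Squarefree D ∧ D ≠ 1) ∨
        (4 ∣ D ∧ (D / 4 % 4 = 2 ∨ D / 4 % 4 = 3) ∧ Squarefree (D / 4))) →
      quadFieldThreeTorsion D = 2 * c D + 1)
    (hcount : ∀ r ∈ ({1, 4, 8} : Finset ℕ), ∀ s ∈ ({1, 3, 5, 7} : Finset ℤ),
      ttLocalFactorTwo (r * s) = 1 →
      (∃ K : ℝ, ∀ ε : ℝ, 0 < ε → ∃ C : ℝ, ∀ X : ℕ, 1 ≤ X →
        |(∑ D ∈ (negFundDiscrs X).filter (fun D => D ≡ r * s [ZMOD ((8 * r : ℕ) : ℤ)]),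
            (c D : ℝ)) - 1 / (2 * r * Real.pi ^ 2) * X
            - K * (X : ℝ) ^ ((5 : ℝ) / 6)| ≤ C * (X : ℝ) ^ ((18 : ℝ) / 23 + ε)) ∧
      (∃ K : ℝ, ∀ ε : ℝ, 0 < ε → ∃ C : ℝ, ∀ X : ℕ, 1 ≤ X →
        |(∑ D ∈ (posFundDiscrs X).filter (fun D => D ≡ r * s [ZMOD ((8 * r : ℕ) : ℤ)]),
            (c D : ℝ)) - 1 / (6 * r * Real.pi ^ 2) * X
            - K * (X : ℝ) ^ ((5 : ℝ) / 6)| ≤ C * (X : ℝ) ^ ((18 : ℝ) / 23 + ε)))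
    (htwist : ∀ r ∈ ({1, 4, 8} : Finset ℕ), ∀ s ∈ ({1, 3, 5, 7} : Finset ℤ),
      ttLocalFactorTwo (r * s) = 1 → ∀ j : ℕ, 4 ≤ j → ∀ ψ : DirichletCharacter ℂ (2 ^ j),
      ψ.IsPrimitive → ψ ^ 6 ≠ 1 →
      (∀ ε : ℝ, 0 < ε → ∃ C : ℝ, ∀ X : ℕ, 1 ≤ X →
        ‖∑ D ∈ (negFundDiscrs X).filter (fun D => D ≡ r * s [ZMOD ((8 * r : ℕ) : ℤ)]),
            ψ (((D / (r : ℤ) : ℤ)) : ZMod (2 ^ j)) * (c D : ℂ)‖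
          ≤ C * (X : ℝ) ^ ((18 : ℝ) / 23 + ε)) ∧
      (∀ ε : ℝ, 0 < ε → ∃ C : ℝ, ∀ X : ℕ, 1 ≤ X →
        ‖∑ D ∈ (posFundDiscrs X).filter (fun D => D ≡ r * s [ZMOD ((8 * r : ℕ) : ℤ)]),
            ψ (((D / (r : ℤ) : ℤ)) : ZMod (2 ^ j)) * (c D : ℂ)‖
          ≤ C * (X : ℝ) ^ ((18 : ℝ) / 23 + ε))) :
    tt_threeTorsion_twoAdic := by
  intro r hr s hs he
  have hneg : ∀ X : ℕ, ∀ D ∈ negFundDiscrs X, quadFieldThreeTorsion D = 2 * c D + 1 :=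
    fun X D hD => hdict D (mem_negFundDiscrs.1 hD).2
  have hpos : ∀ X : ℕ, ∀ D ∈ posFundDiscrs X, quadFieldThreeTorsion D = 2 * c D + 1 :=
    fun X D hD => hdict D (mem_posFundDiscrs.1 hD).2
  have hnegf : ∀ X : ℕ, ∀ D ∈ (negFundDiscrs X).filter
      (fun D => D ≡ r * s [ZMOD ((8 * r : ℕ) : ℤ)]), quadFieldThreeTorsion D = 2 * c D + 1 :=
    fun X D hD => hneg X D (Finset.mem_filter.1 hD).1
  have hposf : ∀ X : ℕ, ∀ D ∈ (posFundDiscrs X).filter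
      (fun D => D ≡ r * s [ZMOD ((8 * r : ℕ) : ℤ)]), quadFieldThreeTorsion D = 2 * c D + 1 :=
    fun X D hD => hpos X D (Finset.mem_filter.1 hD).1
  have hoddn : ∀ X : ℕ, ∀ D ∈ (negFundDiscrs X).filter
      (fun D => D ≡ r * s [ZMOD ((8 * r : ℕ) : ℤ)]), D / (r : ℤ) % 2 = 1 :=
    fun X D hD => ediv_emod_two_eq_one_of_modEq_type hr hs (Finset.mem_filter.1 hD).2
  have hoddp : ∀ X : ℕ, ∀ D ∈ (posFundDiscrs X).filter
      (fun D => D ≡ r * s [ZMOD ((8 * r : ℕ) : ℤ)]), D / (r : ℤ) % 2 = 1 :=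
    fun X D hD => ediv_emod_two_eq_one_of_modEq_type hr hs (Finset.mem_filter.1 hD).2
  refine ⟨⟨(tt_twoAdic_sum_neg_iff_cubicCount hr hs he hneg).2 (hcount r hr s hs he).1,
    (tt_twoAdic_sum_pos_iff_cubicCount hr hs he hpos).2 (hcount r hr s hs he).2⟩,
    fun k χ hχ => ⟨?_, ?_⟩⟩
  · -- negative discriminants: rewrite the weight through the dictionary, then reduce to primitive
    have h := twist_bound_of_primitive (w := fun D => (c D : ℂ)) (θ := (18 : ℝ) / 23) hoddn
      (fun j hj ψ hψ hψ6 => (htwist r hr s hs he j hj ψ hψ hψ6).1) χ hχ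
    intro ε hε
    obtain ⟨C, hC⟩ := h ε hε
    refine ⟨C, fun X hX => ?_⟩
    rw [sum_twist_threeTorsion_eq_sum_twist_cubicCount _ (hnegf X)]
    exact hC X hX
  · have h := twist_bound_of_primitive (w := fun D => (c D : ℂ)) (θ := (18 : ℝ) / 23) hoddp
      (fun j hj ψ hψ hψ6 => (htwist r hr s hs he j hj ψ hψ hψ6).2) χ hχ
    intro ε hε
    obtain ⟨C, hC⟩ := h ε hε
    refine ⟨C, fun X hX => ?_⟩
    rw [sum_twist_threeTorsion_eq_sum_twist_cubicCount _ (hposf X)]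
    exact hC X hX

end Literature.NumberTheory.QuadraticFields

end
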